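import Summits.AtomisticToContinuum.Crystallization.Theorems.FrustratedLawDichotomyStrainedPatchHomEntryFitHcpUCollarLeaf
import Summits.AtomisticToContinuum.Crystallization.Theorems.FrustratedLawDichotomyStrainedPatchHomExteriorLeaf

/-!
# ONE thin certificate, ALL collar kinds: a tagged cell list (sharp fat ∣ sharp cone ∣ U-collar) evaluated over a single `fitOKHDCRSρ`

decomp-a2c hand-2 g41 — structural share for the crux `AperiodicFrustratedLawGap` (stmt-AtomisticToContinuum-27623; `(H) HomFloor`, hcp half).
Driver-facing bookkeeping over #27 (`fatCellSharpOK`, `coneCellSharpOK`) and #29 (`uCollarCellOK`): the thin robust certificate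
`fitOKHDCRSρ c₀ w₀ q ρS e0S` (≈ 50–60 s of kernel time) is evaluated ONCE and serves a MIXED list of cells, each tagged with its kind and integer
witnesses —

* `CollarCell.fat c w`            — #27 sharp fat cell (containment in `U`, sharp-or-window ξ-collar);
* `CollarCell.cone sN sD c w`     — #27 sharp cone cell (dilation `s = sN/sD`);
* `CollarCell.ucol K Mx c w`      — #29 U-collar cell (Frobenius witness `K`, ξ-witness `Mx`).

`collarLeavesOK c₀ w₀ q ρS e0S L` = certificate `&&` `L.all cellOK`; ★★ `semFactsQ_of_collarLeavesOK : collarLeavesOK … L = true → ∀ x ∈ L, semOKHQ μ x.box.1 x.box.2 = true`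
and the projected form on `L.map CollarCell.box` (the `(c, w)` list the manifests of record consume, `…HomCutTreeFacts.facts_append`/`semFactsQ_append`).
Pure bookkeeping; 0 sorry; standard axioms; no instances / notation.  `--supports stmt-AtomisticToContinuum-27623`.
-/

namespace Summit.AtomisticToContinuum.Crystallization.Theorems.FrustratedLawDichotomyStrainedPatchHomEntryFitHcpCollarCells

open Literature.Analysis.ValidatedNumerics.Numerics
open Summit.AtomisticToContinuum.Crystallization.Theorems.FrustratedLawDichotomyStrainedPatchHomExteriorRay (Bx)
open Summit.AtomisticToContinuum.Crystallization.Theorems.FrustratedLawDichotomyStrainedPatchHomEntryFitHcpKit (dEnclH)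
open Summit.AtomisticToContinuum.Crystallization.Theorems.FrustratedLawDichotomyStrainedPatchHomEntryFitHcpCentred (fitOKHDCRSρ)
open Summit.AtomisticToContinuum.Crystallization.Theorems.FrustratedLawDichotomyStrainedPatchHomEntrySemanticQuot (semOKHQ)
open Summit.AtomisticToContinuum.Crystallization.Theorems.FrustratedLawDichotomyStrainedPatchHomEntryFitHcpSharpCollar (fatCellSharpOK coneCellSharpOK
  fatLeafSharpOK coneLeafSharpOK semOKHQ_of_fatLeafSharpOK semOKHQ_of_coneLeafSharpOK)
open Summit.AtomisticToContinuum.Crystallization.Theorems.FrustratedLawDichotomyStrainedPatchHomEntryFitHcpUCollarLeaf (uCollarCellOK uCollarLeafOK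
  semOKHQ_of_uCollarLeafOK)

/-- A tagged collar cell over one thin certificate: sharp fat ∣ sharp cone `(sN, sD)` ∣ U-collar `(K, Mx)`. -/
inductive CollarCell where
  /-- #27 sharp fat cell -/
  | fat (c w : Bx)
  /-- #27 sharp cone cell at dilation `sN/sD` -/
  | cone (sN sD : ℤ) (c w : Bx)
  /-- #29 U-collar cell with witnesses `K ≥ √E`, `Mx ≥ √X` -/
  | ucol (K Mx : ℤ) (c w : Bx)

/-- The certified box `(c, w)` of a tagged cell. -/
def CollarCell.box : CollarCell → Bx × Bx
  | .fat c w => (c, w)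
  | .cone _ _ c w => (c, w)
  | .ucol _ _ c w => (c, w)

/-- The cheap per-cell test by kind (`hi := (dEnclH c₀ w₀).hi` precomputed for cone cells). -/
def CollarCell.ok (c₀ w₀ : Bx) (ρS hi : ℤ) : CollarCell → Bool
  | .fat c w => fatCellSharpOK c₀ w₀ ρS c w
  | .cone sN sD c w => coneCellSharpOK c₀ w₀ ρS hi sN sD c w
  | .ucol K Mx c w => uCollarCellOK c₀ w₀ ρS K Mx c w

/-- ★ **ONE THIN CERTIFICATE + A MIXED LIST OF COLLAR CELLS.** -/
def collarLeavesOK (c₀ w₀ : Bx) (q : Fin 4 → ℤ) (ρS e0S : ℤ) (L : List CollarCell) : Bool :=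
  let hi := (dEnclH c₀ w₀).hi
  fitOKHDCRSρ c₀ w₀ q ρS e0S && L.all fun x => x.ok c₀ w₀ ρS hi

/-- One tagged cell accepted together with the certificate is a `semOKHQ` fact on its box, every level. [case split over #27/#29 soundness] -/
theorem semOKHQ_of_cellOK {μ : ℤ} {c₀ w₀ : Bx} {q : Fin 4 → ℤ} {ρS e0S : ℤ} (hcert : fitOKHDCRSρ c₀ w₀ q ρS e0S = true) (x : CollarCell)
    (hx : x.ok c₀ w₀ ρS (dEnclH c₀ w₀).hi = true) : semOKHQ μ x.box.1 x.box.2 = true := by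
  cases x with
  | fat c w =>
    refine semOKHQ_of_fatLeafSharpOK (q := q) (e0S := e0S) (c₀ := c₀) (w₀ := w₀) (ρS := ρS) ?_
    simp only [fatLeafSharpOK, Bool.and_eq_true]
    exact ⟨hx, hcert⟩
  | cone sN sD c w =>
    refine semOKHQ_of_coneLeafSharpOK (q := q) (e0S := e0S) (c₀ := c₀) (w₀ := w₀) (ρS := ρS) (sN := sN) (sD := sD) ?_
    simp only [coneLeafSharpOK, Bool.and_eq_true]
    exact ⟨hx, hcert⟩
  | ucol K Mx c w =>
    refine semOKHQ_of_uCollarLeafOK (q := q) (e0S := e0S) (c₀ := c₀) (w₀ := w₀) (ρS := ρS) (K := K) (Mx := Mx) ?_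
    simp only [uCollarLeafOK, Bool.and_eq_true]
    exact ⟨hx, hcert⟩

/-- ★★ **A MIXED LIST OVER ONE CERTIFICATE ⟹ `semOKHQ` facts on every listed box**, every level `μ`. [formal bookkeeping] -/
theorem semFactsQ_of_collarLeavesOK {μ : ℤ} {c₀ w₀ : Bx} {q : Fin 4 → ℤ} {ρS e0S : ℤ} {L : List CollarCell}
    (h : collarLeavesOK c₀ w₀ q ρS e0S L = true) : ∀ x ∈ L, semOKHQ μ x.box.1 x.box.2 = true := by
  simp only [collarLeavesOK, Bool.and_eq_true, List.all_eq_true] at h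
  exact fun x hx => semOKHQ_of_cellOK h.1 x (h.2 x hx)

/-- The same facts on the projected `(c, w)` list (the shape `…HomCutTreeFacts.facts_append` / `semOKHQ_root_of_colManifest5Q` consume).
[formal bookkeeping] -/
theorem semFactsQ_of_collarLeavesOK_map {μ : ℤ} {c₀ w₀ : Bx} {q : Fin 4 → ℤ} {ρS e0S : ℤ} {L : List CollarCell}
    (h : collarLeavesOK c₀ w₀ q ρS e0S L = true) : ∀ b ∈ L.map CollarCell.box, semOKHQ μ b.1 b.2 = true := by
  intro b hb
  obtain ⟨x, hx, rfl⟩ := List.mem_map.1 hb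
  exact semFactsQ_of_collarLeavesOK h x hx

end Summit.AtomisticToContinuum.Crystallization.Theorems.FrustratedLawDichotomyStrainedPatchHomEntryFitHcpCollarCells
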